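import Literature.Barriers.CriticalPhenomena.LaceExpansionIsingGreenComparisonSymbols
import Mathlib.MeasureTheory.Function.LpSeminorm.Basic
import Mathlib.Analysis.SpecialFunctions.Integrals.Basic
import HarnessLib

/-!
# Liu–Slade 2026, Lemma 3.6 for the pure derivatives: `‖∂_l^j D̂‖_{L^q([-π,π]^d)} ≲ L^{j - d/q}`,
# and the decay `D(x) ≲ L^a/⟦x⟧^{d+a}` of the spread-out step distribution

Barrier catalogue `Literature/Barriers/CriticalPhenomena/` (D-0021), infrastructure for the proof
of the named fact `SpreadOutIsing.LiuSlade2026_thm22` (Liu–Slade 2026, Theorem 2.2), whose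
Proposition 3.2 rests on Lemma 3.6 (App. B): "If `L ≥ L₀` … For any `a > 0`,
`D(x) ≲ L^a/⟦x⟧^{d+a}` (3.14). … For each multi-index `α`, `‖D̂_α‖_q ≲ L^{|α| - d/q}`
(`0 ≤ q⁻¹ < 1`) (3.16)." For Sakai's uniformly spread-out step distribution `D = soStep d L`
(the punctured cube, an instance of Def. 1.1) both are explicit and hold for every `L ≥ 1`; this
file PROVES them for the pure derivatives `α = j e_l` (the only ones the one-axis form of
Lemma 3.1, `LiuSlade2026_lem31_fiber_holds`, consumes), on the Brillouin zone `cube d = [-π,π]^d`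
with Lebesgue measure and Mathlib's `eLpNorm`:

* `integral_dirichletCutoff_rpow_le` — `∫_{-π}^{π} m_L(t)^q dt ≤ (2π/L)·q/(q-1)` for `q > 1`
  (`m_L(t) = π/max(π, L|t|)`, the tree's `dirichletCutoff`; App. B: "`∫_{1/L}^{π} t^{-q} dt`");
* `integral_cube_dirichletMajorant_rpow_le` — `∫_{[-π,π]^d} M_L^q ≤ ((2π/L)·q/(q-1))^d`
  (`M_L(k) = Π_i m_L(k_i)`, `dirichletMajorant`; Fubini);
* `eLpNorm_soSymbolD_le` — **(3.16) for `α = j e_l`, `j ≥ 1`, `1 < q < ∞`**: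
  `‖∂_l^j D̂‖_{L^q([-π,π]^d)} ≤ 4 (2πq/(q-1))^{d/q} L^{j - d/q}`, from the tree's Dirichlet-kernel
  bound `|∂_l^j D̂| ≤ 4L^j M_L` (`abs_soSymbolD_le_dirichletMajorant`); `eLpNorm_soSymbolD_top_le`
  — the case `q = ∞`: `‖∂_l^j D̂‖_∞ ≤ L^j` (`abs_soSymbolD_le`);
* `soStep_le_pow_mul_div_jnorm_rpow` — **(3.14)**: `D(x) ≤ d^{(d+a)/2} L^a/⟦x⟧^{d+a}` for every
  `a ≥ 0` (`D = 1/N_L` on `0 < ‖x‖_∞ ≤ L`, `N_L ≥ L^d`, `⟦x⟧ ≤ √d L` there).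

The order-zero bound `‖D̂‖_q ≲ L^{-d/q}` and mixed multi-indices are not needed downstream and are
not included; the infrared bound (3.15) is the tree's `infrared_lower_bound`.

## References

* Y. Liu, G. Slade, *Gaussian deconvolution and the lace expansion for spread-out models*,
  Ann. Inst. H. Poincaré Probab. Statist. 62 (2026), arXiv:2310.07640: Lemma 3.6 with
  (3.14)–(3.16), Appendix B (proof of Lemma 3.6) [LiuSlade2026]. Equation numbers are those of the
  arXiv version held in the literature store.
-/

noncomputable section

namespace Literature.Barriers.CriticalPhenomena.SpreadOutIsing

open _root_.MeasureTheory Filter _root_.Topology Finset Literature.Probability.LatticeModels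
open scoped BigOperators Real ENNReal

variable {d L : ℕ}

/-! ## `L^q` norms of the Dirichlet majorant -/

/-- **`∫_{-π}^{π} m_L(t)^q dt ≤ (2π/L)·q/(q-1)`** for `L ≥ 1`, `q > 1`: `m_L ≤ 1` on `[0, π/L]` and
`m_L(t) = π/(Lt)` on `[π/L, π]`, where `∫_{π/L}^{π} (π/(Lt))^q dt ≤ (π/L)/(q-1)`.
[cite: LiuSlade2026, App. B (proof of (3.16): the integral ∫_{1/L}^π t^{-q} dt)] -/
theorem integral_dirichletCutoff_rpow_le {L : ℝ} (hL : 1 ≤ L) {q : ℝ} (hq : 1 < q) :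
    ∫ t in -π..π, dirichletCutoff L t ^ q ≤ 2 * π / L * (q / (q - 1)) := by
  have hL0 : 0 < L := lt_of_lt_of_le one_pos hL
  have hπL : 0 < π / L := div_pos Real.pi_pos hL0
  have hπLπ : π / L ≤ π := div_le_self Real.pi_pos.le hL
  have hq0 : 0 ≤ q := by linarith
  have hq1 : 0 < q - 1 := by linarith
  have hcont : Continuous fun t => dirichletCutoff L t ^ q :=
    (continuous_dirichletCutoff L).rpow_const fun t => Or.inl (dirichletCutoff_pos L t).ne'
  have hint : ∀ a b : ℝ, IntervalIntegrable (fun t => dirichletCutoff L t ^ q) volume a b := fun a b =>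
    hcont.intervalIntegrable a b
  -- evenness
  have hneg : ∫ t in -π..0, dirichletCutoff L t ^ q = ∫ t in (0 : ℝ)..π, dirichletCutoff L t ^ q := by
    have h := intervalIntegral.integral_comp_neg (a := 0) (b := π) (fun t => dirichletCutoff L t ^ q)
    simp only [dirichletCutoff_neg, neg_zero] at h
    exact h.symm
  have hsplit : ∫ t in -π..π, dirichletCutoff L t ^ q = 2 * ∫ t in (0 : ℝ)..π, dirichletCutoff L t ^ q := by
    rw [← intervalIntegral.integral_add_adjacent_intervals (hint (-π) 0) (hint 0 π), hneg]; ring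
  -- `∫_0^{π/L} m^q ≤ π/L`
  have h1 : ∫ t in (0 : ℝ)..π / L, dirichletCutoff L t ^ q ≤ π / L := by
    have := intervalIntegral.integral_mono_on hπL.le (hint 0 (π / L)) intervalIntegrable_const
      (fun t _ => Real.rpow_le_one (dirichletCutoff_pos L t).le (dirichletCutoff_le_one L t) hq0)
    simpa using this
  -- `∫_{π/L}^{π} m^q ≤ (π/L)/(q-1)`
  have h2 : ∫ t in π / L..π, dirichletCutoff L t ^ q ≤ π / L / (q - 1) := by
    have heq : ∀ t ∈ Set.uIcc (π / L) π, dirichletCutoff L t ^ q = (π / L) ^ q * t ^ (-q) := by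
      intro t ht
      rw [Set.uIcc_of_le hπLπ] at ht
      have ht0 : 0 < t := lt_of_lt_of_le hπL ht.1
      have hle : π ≤ L * t := by
        calc π = L * (π / L) := by field_simp
          _ ≤ L * t := mul_le_mul_of_nonneg_left ht.1 hL0.le
      rw [dirichletCutoff_eq_of_le ht0 hle, Real.mul_rpow hπL.le (inv_nonneg.2 ht0.le),
        Real.inv_rpow ht0.le, Real.rpow_neg ht0.le]
    rw [intervalIntegral.integral_congr heq, intervalIntegral.integral_const_mul]
    have h0 : (0 : ℝ) ∉ Set.uIcc (π / L) π := by
      rw [Set.uIcc_of_le hπLπ]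
      intro h
      exact (lt_irrefl _ (lt_of_lt_of_le hπL h.1))
    rw [integral_rpow (Or.inr ⟨by linarith, h0⟩)]
    have hexp : -q + 1 = -(q - 1) := by ring
    rw [hexp]
    -- `((π)^{-(q-1)} - (π/L)^{-(q-1)})/(-(q-1)) = ((π/L)^{-(q-1)} - π^{-(q-1)})/(q-1) ≤ (π/L)^{-(q-1)}/(q-1)`
    have hπ0 : 0 < π := Real.pi_pos
    have hA : 0 ≤ π ^ (-(q - 1)) := Real.rpow_nonneg hπ0.le _
    have hkey : (π / L) ^ q * ((π ^ (-(q - 1)) - (π / L) ^ (-(q - 1))) / -(q - 1)) ≤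
        (π / L) ^ q * ((π / L) ^ (-(q - 1)) / (q - 1)) := by
      refine mul_le_mul_of_nonneg_left ?_ (Real.rpow_nonneg hπL.le q)
      rw [div_neg, ← neg_div, neg_sub, div_le_div_iff_of_pos_right hq1]
      linarith
    refine hkey.trans (le_of_eq ?_)
    rw [← mul_div_assoc, ← Real.rpow_add hπL]
    have : q + -(q - 1) = 1 := by ring
    rw [this, Real.rpow_one]
  rw [hsplit, ← intervalIntegral.integral_add_adjacent_intervals (hint 0 (π / L)) (hint (π / L) π)]
  have e : 2 * π / L * (q / (q - 1)) = 2 * (π / L + π / L / (q - 1)) := by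
    field_simp
    ring
  rw [e]
  linarith

/-- `0 ≤ ∫_{-π}^{π} m_L^q`. [folklore] -/
theorem integral_dirichletCutoff_rpow_nonneg (L q : ℝ) : 0 ≤ ∫ t in -π..π, dirichletCutoff L t ^ q :=
  intervalIntegral.integral_nonneg (by linarith [Real.pi_pos]) fun t _ =>
    Real.rpow_nonneg (dirichletCutoff_pos L t).le q

/-- **`∫_{[-π,π]^d} M_L(k)^q dk ≤ ((2π/L)·q/(q-1))^d`** for `L ≥ 1`, `q > 1` (Fubini for the
product `M_L^q = Π_i m_L(k_i)^q`). [cite: LiuSlade2026, App. B (proof of (3.16))] -/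
theorem integral_cube_dirichletMajorant_rpow_le {L : ℝ} (hL : 1 ≤ L) {q : ℝ} (hq : 1 < q) :
    ∫ k in cube d, dirichletMajorant L k ^ q ≤ (2 * π / L * (q / (q - 1))) ^ d := by
  have hprod : ∫ k in cube d, dirichletMajorant L k ^ q =
      ∏ _j : Fin d, ∫ t in Set.Icc (-π) π, dirichletCutoff L t ^ q := by
    have hpt : ∀ k : Fin d → ℝ, dirichletMajorant L k ^ q = ∏ j, dirichletCutoff L (k j) ^ q := fun k => by
      rw [dirichletMajorant, ← Real.finsetProd_rpow _ _ (fun i _ => (dirichletCutoff_pos L (k i)).le) q]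
    simp_rw [hpt]
    rw [cube, volume_pi, Measure.restrict_pi_pi]
    exact integral_fintype_prod_eq_prod (fun (_ : Fin d) (t : ℝ) => dirichletCutoff L t ^ q)
  rw [hprod, Finset.prod_const, Finset.card_univ, Fintype.card_fin]
  have h1 : ∫ t in Set.Icc (-π) π, dirichletCutoff L t ^ q = ∫ t in -π..π, dirichletCutoff L t ^ q := by
    rw [intervalIntegral.integral_of_le (by linarith [Real.pi_pos]), integral_Icc_eq_integral_Ioc]
  rw [h1]
  exact pow_le_pow_left₀ (integral_dirichletCutoff_rpow_nonneg L q) (integral_dirichletCutoff_rpow_le hL hq) d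

/-! ## From a pointwise majorant to an `L^q` bound -/

/-- If `|g| ≤ h` on the cube with `h ≥ 0` continuous, then for `q > 0`,
`‖g‖_{L^q([-π,π]^d)} ≤ (∫_{[-π,π]^d} h^q)^{1/q}` (`g` a.e.-strongly measurable). [folklore] -/
theorem eLpNorm_le_of_abs_le {g h : (Fin d → ℝ) → ℝ} (hh : Continuous h) (hh0 : ∀ k, 0 ≤ h k)
    {q : ℝ} (hq : 0 < q) (hle : ∀ k ∈ cube d, |g k| ≤ h k) :
    eLpNorm g (ENNReal.ofReal q) (volume.restrict (cube d)) ≤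
      ENNReal.ofReal ((∫ k in cube d, h k ^ q) ^ (1 / q)) := by
  have hqne : ENNReal.ofReal q ≠ 0 := by simpa using hq
  have hint : IntegrableOn (fun k => h k ^ q) (cube d) :=
    ((hh.rpow_const fun k => Or.inr hq.le).continuousOn).integrableOn_compact
      (isCompact_univ_pi fun (_ : Fin d) => isCompact_Icc)
  have hI0 : 0 ≤ ∫ k in cube d, h k ^ q := integral_nonneg fun k => Real.rpow_nonneg (hh0 k) q
  rw [eLpNorm_eq_lintegral_rpow_enorm_toReal hqne ENNReal.ofReal_ne_top, ENNReal.toReal_ofReal hq.le,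
    ← ENNReal.ofReal_rpow_of_nonneg hI0 (by positivity)]
  gcongr
  rw [ofReal_integral_eq_lintegral_ofReal hint (ae_of_all _ fun k => Real.rpow_nonneg (hh0 k) q)]
  refine setLIntegral_mono' (measurableSet_cube d) fun k hk => ?_
  rw [Real.enorm_eq_ofReal_abs, ENNReal.ofReal_rpow_of_nonneg (abs_nonneg _) hq.le]
  exact ENNReal.ofReal_le_ofReal (Real.rpow_le_rpow (abs_nonneg _) (hle k hk) hq.le)

/-! ## (3.16) for the pure derivatives `∂_l^j D̂` -/

/-- **Liu–Slade 2026, (3.16), for `α = j e_l`, `j ≥ 1`, `1 < q < ∞`**: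
`‖∂_l^j D̂‖_{L^q([-π,π]^d)} ≤ 4 (2πq/(q-1))^{d/q} L^{j - d/q}` for every `L ≥ 1` (`d ≥ 1`;
`∂_l^j D̂ = soSymbolD d L l j`, Lebesgue measure on the cube). Proof: the Dirichlet-kernel bound
`|∂_l^j D̂| ≤ 4 L^j M_L` and `∫ M_L^q ≤ ((2π/L)q/(q-1))^d`.
[cite: LiuSlade2026, Lemma 3.6 (3.16) and App. B] -/
theorem eLpNorm_soSymbolD_le (hd : 1 ≤ d) (hL : 1 ≤ L) (l : Fin d) {j : ℕ} (hj : 1 ≤ j) {q : ℝ}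
    (hq : 1 < q) :
    eLpNorm (soSymbolD d L l j) (ENNReal.ofReal q) (volume.restrict (cube d)) ≤
      ENNReal.ofReal (4 * (2 * π * q / (q - 1)) ^ ((d : ℝ) / q) * (L : ℝ) ^ ((j : ℝ) - d / q)) := by
  have hq0 : 0 < q := by linarith
  have hq1 : 0 < q - 1 := by linarith
  have hL1 : (1 : ℝ) ≤ L := by exact_mod_cast hL
  have hL0 : (0 : ℝ) < L := by linarith
  set h : (Fin d → ℝ) → ℝ := fun k => 4 * (L : ℝ) ^ j * dirichletMajorant (L : ℝ) k with hhdef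
  have hhc : Continuous h := continuous_const.mul (continuous_dirichletMajorant _)
  have hh0 : ∀ k, 0 ≤ h k := fun k => by
    rw [hhdef]; exact mul_nonneg (by positivity) (dirichletMajorant_pos _ k).le
  refine (eLpNorm_le_of_abs_le hhc hh0 hq0 fun k hk => abs_soSymbolD_le_dirichletMajorant hd hL l hj hk).trans ?_
  refine ENNReal.ofReal_le_ofReal ?_
  -- `∫ h^q = (4L^j)^q ∫ M_L^q ≤ (4L^j)^q ((2π/L) q/(q-1))^d`
  have hc0 : 0 ≤ 4 * (L : ℝ) ^ j := by positivity
  have hIq : ∫ k in cube d, h k ^ q = (4 * (L : ℝ) ^ j) ^ q * ∫ k in cube d, dirichletMajorant (L : ℝ) k ^ q := by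
    rw [← integral_const_mul]
    refine setIntegral_congr_fun (measurableSet_cube d) fun k _ => ?_
    rw [hhdef]
    exact Real.mul_rpow hc0 (dirichletMajorant_pos _ k).le
  have hM := integral_cube_dirichletMajorant_rpow_le (d := d) hL1 hq
  have hM0 : 0 ≤ ∫ k in cube d, dirichletMajorant (L : ℝ) k ^ q :=
    integral_nonneg fun k => Real.rpow_nonneg (dirichletMajorant_pos _ k).le q
  set B : ℝ := 2 * π / L * (q / (q - 1)) with hBdef
  have hB0 : 0 ≤ B := by rw [hBdef]; positivity
  calc (∫ k in cube d, h k ^ q) ^ (1 / q)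
      ≤ ((4 * (L : ℝ) ^ j) ^ q * B ^ d) ^ (1 / q) := by
        rw [hIq]
        exact Real.rpow_le_rpow (mul_nonneg (Real.rpow_nonneg hc0 q) hM0)
          (mul_le_mul_of_nonneg_left hM (Real.rpow_nonneg hc0 q)) (by positivity)
    _ = 4 * (L : ℝ) ^ j * (B ^ d) ^ (1 / q) := by
        rw [Real.mul_rpow (Real.rpow_nonneg hc0 q) (pow_nonneg hB0 d), one_div,
          Real.rpow_rpow_inv hc0 hq0.ne']
    _ = 4 * (2 * π * q / (q - 1)) ^ ((d : ℝ) / q) * (L : ℝ) ^ ((j : ℝ) - d / q) := by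
        -- `(B^d)^{1/q} = (2πq/(q-1))^{d/q} L^{-d/q}` and `L^j L^{-d/q} = L^{j - d/q}`
        set C : ℝ := 2 * π * q / (q - 1) with hCdef
        have hC0 : 0 ≤ C := by rw [hCdef]; positivity
        have hB : B = C * (L : ℝ)⁻¹ := by rw [hBdef, hCdef]; field_simp
        have h1 : (B ^ d) ^ (1 / q) = C ^ ((d : ℝ) / q) * (L : ℝ) ^ (-((d : ℝ) / q)) := by
          rw [hB, ← Real.rpow_natCast (C * (L : ℝ)⁻¹) d,
            ← Real.rpow_mul (mul_nonneg hC0 (inv_nonneg.2 hL0.le)),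
            show (d : ℝ) * (1 / q) = d / q by ring,
            Real.mul_rpow hC0 (inv_nonneg.2 hL0.le), Real.inv_rpow hL0.le, ← Real.rpow_neg hL0.le]
        have h2 : (L : ℝ) ^ j * (L : ℝ) ^ (-((d : ℝ) / q)) = (L : ℝ) ^ ((j : ℝ) - d / q) := by
          rw [← Real.rpow_natCast (L : ℝ) j, ← Real.rpow_add hL0, sub_eq_add_neg]
        rw [h1, ← h2]
        ring

/-- **(3.16) at `q = ∞`**: `‖∂_l^j D̂‖_{L^∞([-π,π]^d)} ≤ L^j` (`d, L ≥ 1`; `abs_soSymbolD_le`).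
[cite: LiuSlade2026, Lemma 3.6 (3.16) and App. B (|D̂_α| ≤ Σ_x|x^α|D(x) ≤ L^{|α|})] -/
theorem eLpNorm_soSymbolD_top_le (hd : 1 ≤ d) (hL : 1 ≤ L) (l : Fin d) (j : ℕ) :
    eLpNorm (soSymbolD d L l j) ∞ (volume.restrict (cube d)) ≤ ENNReal.ofReal ((L : ℝ) ^ j) := by
  rw [eLpNorm_exponent_top]
  refine eLpNormEssSup_le_of_ae_bound (ae_of_all _ fun k => ?_)
  rw [Real.norm_eq_abs]
  exact abs_soSymbolD_le hd hL l j k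

/-! ## (3.14): the decay of the spread-out step distribution -/

/-- **Liu–Slade 2026, (3.14)** for the punctured cube: for every `a ≥ 0` and `L ≥ 1` (`d ≥ 1`),
`D(x) ≤ d^{(d+a)/2} L^a / ⟦x⟧^{d+a}` (`D = soStep d L`, `⟦x⟧ = jnorm x`): on its support
`0 < ‖x‖_∞ ≤ L` one has `D(x) = 1/N_L ≤ L^{-d}` and `⟦x⟧ ≤ √d L`.
[cite: LiuSlade2026, Lemma 3.6 (3.14)] -/
theorem soStep_le_pow_mul_div_jnorm_rpow (hd : 1 ≤ d) (hL : 1 ≤ L) {a : ℝ} (ha : 0 ≤ a)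
    (x : Site d) :
    soStep d L x ≤ (d : ℝ) ^ (((d : ℝ) + a) / 2) * (L : ℝ) ^ a / jnorm x ^ ((d : ℝ) + a) := by
  have hL1 : (1 : ℝ) ≤ L := by exact_mod_cast hL
  have hL0 : (0 : ℝ) < L := by linarith
  have hd1 : (1 : ℝ) ≤ d := by exact_mod_cast hd
  have hjpos := jnorm_pos x
  have hRHS : 0 ≤ (d : ℝ) ^ (((d : ℝ) + a) / 2) * (L : ℝ) ^ a / jnorm x ^ ((d : ℝ) + a) := by positivity
  by_cases hx : (spreadOutGraph d L).Adj 0 x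
  · -- on the support
    have hmem : x ∈ (spreadOutGraph d L).neighborFinset 0 := (SimpleGraph.mem_neighborFinset _ _ _).2 hx
    -- `⟦x⟧ ≤ √d L`
    have hcoord : ∀ i, |((x i : ℤ) : ℝ)| ≤ L := fun i => abs_apply_le_of_mem_neighborFinset hmem i
    have heucl : euclidNorm x ≤ Real.sqrt d * L := by
      unfold euclidNorm
      calc Real.sqrt (∑ i, ((x i : ℤ) : ℝ) ^ 2) ≤ Real.sqrt (∑ _i : Fin d, (L : ℝ) ^ 2) := by
            refine Real.sqrt_le_sqrt (Finset.sum_le_sum fun i _ => ?_)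
            rw [← sq_abs]
            exact pow_le_pow_left₀ (abs_nonneg _) (hcoord i) 2
        _ = Real.sqrt d * L := by
            rw [Finset.sum_const, Finset.card_univ, Fintype.card_fin, nsmul_eq_mul,
              Real.sqrt_mul (Nat.cast_nonneg d), Real.sqrt_sq hL0.le]
    have hsd : 1 ≤ Real.sqrt d * L :=
      one_le_mul_of_one_le_of_one_le (Real.one_le_sqrt.2 hd1) hL1
    have hj : jnorm x ≤ Real.sqrt d * L := max_le heucl hsd
    -- `D(x) ≤ 1/N_L ≤ L^{-d}`
    have hN : (L : ℝ) ^ d ≤ soCount d L := by exact_mod_cast pow_le_soCount hd L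
    have hD : soStep d L x ≤ ((L : ℝ) ^ d)⁻¹ :=
      (soStep_le_inv x).trans (inv_anti₀ (pow_pos hL0 d) hN)
    refine hD.trans ?_
    rw [le_div_iff₀ (Real.rpow_pos_of_pos hjpos _)]
    -- `L^{-d} ⟦x⟧^{d+a} ≤ L^{-d} (√d L)^{d+a} = d^{(d+a)/2} L^a`
    have hda : 0 ≤ (d : ℝ) + a := by positivity
    calc ((L : ℝ) ^ d)⁻¹ * jnorm x ^ ((d : ℝ) + a)
        ≤ ((L : ℝ) ^ d)⁻¹ * (Real.sqrt d * L) ^ ((d : ℝ) + a) :=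
          mul_le_mul_of_nonneg_left (Real.rpow_le_rpow hjpos.le hj hda) (by positivity)
      _ = (d : ℝ) ^ (((d : ℝ) + a) / 2) * (L : ℝ) ^ a := by
          have h1 : (Real.sqrt d * L) ^ ((d : ℝ) + a) = (d : ℝ) ^ (((d : ℝ) + a) / 2) * ((L : ℝ) ^ d * (L : ℝ) ^ a) := by
            rw [Real.mul_rpow (Real.sqrt_nonneg _) hL0.le, Real.sqrt_eq_rpow, ← Real.rpow_mul (Nat.cast_nonneg d),
              Real.rpow_add hL0, Real.rpow_natCast]
            congr 1
            ring_nf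
          rw [h1]
          field_simp
  · rw [soStep_of_not_adj hx]
    exact hRHS

end Literature.Barriers.CriticalPhenomena.SpreadOutIsing

end
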